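import Mathlib

/-!
# Resultants of an odd-coefficient polynomial with `X^n ∓ 1`, `X^{2n} + 1` (venture `DiscreteObjects`, target L)

Cell `pub-namedobj`, seat `pub-namedobj-mahler` (gen 8). Framing: lottery ticket; floor = certified
bounds/negative ranges.

This is Lemma 3.1 (case `m = 2`) of Borwein–Dobrowolski–Mossinghoff, *Lehmer's problem for polynomials
with odd coefficients*, Ann. of Math. 166 (2007) 347–366, in Mathlib's vocabulary
(`Polynomial.resultant`, explicit Sylvester formats `(deg f, N)`):

* `exists_X_pow_sub_one_eq_of_odd` — if all coefficients `f_0, …, f_d` of `f ∈ ℤ[X]` are odd then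
  `X^{d+1} - 1 = 2 s + f · (X - 1)` for some `s ∈ ℤ[X]` with `deg s ≤ d + 1` ((3.3) of the paper);
* `two_pow_le_abs_resultant` — if `G = 2 T + f · P` with `deg P + deg f ≤ N` and `Res(f, G) ≠ 0` then
  `2^{deg f} ≤ |Res(f, G)|`; applied to `G = X^{d+1} - 1`, `X^{d+1} + 1`, `X^{2(d+1)} + 1`
  (`two_pow_le_abs_resultant_X_pow_sub_one` / `_add_one` / `_X_pow_two_mul_add_one`);
* `resultant_intCast_eq` — over `ℂ`, `Res(f, G) = a^N ∏_{f(α)=0} G(α)` (Mathlib's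
  `resultant_eq_prod_eval`), and `pow_ne_one_of_cyclotomicFree` — the roots of a cyclotomic-free
  integer polynomial are not roots of unity, so these resultants are nonzero
  (`resultant_ne_zero_of_cyclotomicFree`).

These feed the proof of [BDM07, Cor. 3.4] in `OddCoefficientsMahlerBound`.
-/

namespace Summit.Ventures.DiscreteObjects.Mahler

open Polynomial

/-- A polynomial all of whose coefficients up to the degree are odd is nonzero. -/
theorem ne_zero_of_odd_coeffs {f : ℤ[X]} (hodd : ∀ i ≤ f.natDegree, Odd (f.coeff i)) : f ≠ 0 := by
  intro hf
  have h0 := hodd 0 (Nat.zero_le _)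
  rw [hf, coeff_zero] at h0
  exact (by decide : ¬ Odd (0 : ℤ)) h0

/-- `deg (X - 1) = 1` over `ℤ`. -/
theorem natDegree_X_sub_one : (X - 1 : ℤ[X]).natDegree = 1 := by
  rw [← C_1, natDegree_X_sub_C]

/-- **[BDM07, (3.3)], `m = 2`.** If all coefficients `f_0, …, f_d` of `f ∈ ℤ[X]` are odd, then
`X^{d+1} - 1 = 2 s + f · (X - 1)` for some `s ∈ ℤ[X]` with `deg s ≤ d + 1`
(coefficientwise: `(X - 1) f ≡ X^{d+1} - 1 (mod 2)`). -/
theorem exists_X_pow_sub_one_eq_of_odd {f : ℤ[X]} (hodd : ∀ i ≤ f.natDegree, Odd (f.coeff i)) :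
    ∃ s : ℤ[X], s.natDegree ≤ f.natDegree + 1 ∧
      (X ^ (f.natDegree + 1) - 1 : ℤ[X]) = C 2 * s + f * (X - 1) := by
  have hfX : f * (X - 1) = X * f - f := by ring
  have hcoeff : ∀ j, (2 : ℤ) ∣ (X ^ (f.natDegree + 1) - 1 - f * (X - 1) : ℤ[X]).coeff j := by
    intro j
    rcases j with _ | i
    · -- constant coefficient: `f_0 - 1`
      have h0 : (X ^ (f.natDegree + 1) - 1 - f * (X - 1) : ℤ[X]).coeff 0 = f.coeff 0 - 1 := by
        rw [hfX, coeff_sub, coeff_sub, coeff_sub, coeff_X_pow, coeff_one_zero, coeff_X_mul_zero,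
          if_neg (by omega)]
        ring
      obtain ⟨k, hk⟩ := hodd 0 (Nat.zero_le _)
      rw [h0, hk]
      exact ⟨k, by ring⟩
    · have hi : (X ^ (f.natDegree + 1) - 1 - f * (X - 1) : ℤ[X]).coeff (i + 1) =
          (if i + 1 = f.natDegree + 1 then 1 else 0) - (f.coeff i - f.coeff (i + 1)) := by
        rw [hfX, coeff_sub, coeff_sub, coeff_sub, coeff_X_pow, coeff_one, coeff_X_mul,
          if_neg (show ¬ (i + 1 = 0) by omega)]
        ring
      rw [hi]
      rcases Nat.lt_trichotomy i f.natDegree with hlt | heq | hgt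
      · -- interior coefficient: difference of two odd numbers
        have hne : ¬ (i + 1 = f.natDegree + 1) := by omega
        rw [if_neg hne]
        obtain ⟨k, hk⟩ := hodd i hlt.le
        obtain ⟨l, hl⟩ := hodd (i + 1) (by omega)
        rw [hk, hl]
        exact ⟨l - k, by ring⟩
      · -- top coefficient: `1 - f_d`
        rw [if_pos (by rw [heq]), coeff_eq_zero_of_natDegree_lt (n := i + 1) (by omega)]
        obtain ⟨k, hk⟩ := hodd i heq.le
        rw [hk]
        exact ⟨-k, by ring⟩
      · -- beyond the degree: zero
        have hne : ¬ (i + 1 = f.natDegree + 1) := by omega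
        rw [if_neg hne, coeff_eq_zero_of_natDegree_lt (n := i) (by omega),
          coeff_eq_zero_of_natDegree_lt (n := i + 1) (by omega)]
        simp
  obtain ⟨s, hs⟩ := (C_dvd_iff_dvd_coeff (2 : ℤ) _).mpr hcoeff
  refine ⟨s, ?_, ?_⟩
  · -- degree bound
    have h2 : (C (2 : ℤ) * s).natDegree = s.natDegree := natDegree_C_mul (by norm_num)
    have hgdeg : (X ^ (f.natDegree + 1) - 1 - f * (X - 1) : ℤ[X]).natDegree ≤ f.natDegree + 1 := by
      refine (natDegree_sub_le _ _).trans (max_le ?_ ?_)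
      · refine (natDegree_sub_le _ _).trans (max_le ?_ ?_)
        · rw [natDegree_X_pow]
        · simp
      · refine natDegree_mul_le.trans ?_
        rw [natDegree_X_sub_one]
    rw [← h2, ← hs]
    exact hgdeg
  · rw [← hs]
    ring

/-- **[BDM07, Lemma 3.1], abstract form.** If `G = 2 T + f · P` with `deg P + deg f ≤ N` and the
resultant `Res_{(deg f, N)}(f, G)` is nonzero, then `2^{deg f} ≤ |Res(f, G)|`: indeed
`Res(f, G) = Res(f, 2T) = 2^{deg f} Res(f, T)` and `Res(f, T)` is a nonzero integer. -/
theorem two_pow_le_abs_resultant {f G T P : ℤ[X]} {N : ℕ} (hG : G = C 2 * T + f * P)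
    (hP : P.natDegree + f.natDegree ≤ N) (hne : f.resultant G f.natDegree N ≠ 0) :
    (2 : ℤ) ^ f.natDegree ≤ |f.resultant G f.natDegree N| := by
  have h1 : f.resultant G f.natDegree N = 2 ^ f.natDegree * f.resultant T f.natDegree N := by
    rw [hG, resultant_add_mul_right f (C 2 * T) P f.natDegree N hP le_rfl, resultant_C_mul_right]
  rw [h1] at hne ⊢
  have hT : f.resultant T f.natDegree N ≠ 0 := by
    intro h
    apply hne
    rw [h, mul_zero]
  have h1T : 1 ≤ |f.resultant T f.natDegree N| := Int.one_le_abs hT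
  rw [abs_mul, abs_pow, abs_two]
  calc (2 : ℤ) ^ f.natDegree = 2 ^ f.natDegree * 1 := by ring
    _ ≤ 2 ^ f.natDegree * |f.resultant T f.natDegree N| :=
        mul_le_mul_of_nonneg_left h1T (by positivity)

/-- `2^{d} ≤ |Res(f, X^{d+1} - 1)|` for `f` with odd coefficients `f_0, …, f_d`, provided the
resultant is nonzero [BDM07, (3.1) with `m = 2`, `g = f`]. -/
theorem two_pow_le_abs_resultant_X_pow_sub_one {f : ℤ[X]} (hodd : ∀ i ≤ f.natDegree, Odd (f.coeff i))
    (hne : f.resultant (X ^ (f.natDegree + 1) - 1) f.natDegree (f.natDegree + 1) ≠ 0) :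
    (2 : ℤ) ^ f.natDegree ≤ |f.resultant (X ^ (f.natDegree + 1) - 1) f.natDegree (f.natDegree + 1)| := by
  obtain ⟨s, _, hs⟩ := exists_X_pow_sub_one_eq_of_odd hodd
  refine two_pow_le_abs_resultant (T := s) (P := X - 1) hs ?_ hne
  rw [natDegree_X_sub_one]; omega

/-- `2^{d} ≤ |Res(f, X^{d+1} + 1)|` for `f` with odd coefficients, provided the resultant is nonzero
[BDM07, (3.2) with `k = 0`]: `X^{d+1} + 1 = 2 (s + 1) + f · (X - 1)`. -/
theorem two_pow_le_abs_resultant_X_pow_add_one {f : ℤ[X]} (hodd : ∀ i ≤ f.natDegree, Odd (f.coeff i))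
    (hne : f.resultant (X ^ (f.natDegree + 1) + 1) f.natDegree (f.natDegree + 1) ≠ 0) :
    (2 : ℤ) ^ f.natDegree ≤ |f.resultant (X ^ (f.natDegree + 1) + 1) f.natDegree (f.natDegree + 1)| := by
  obtain ⟨s, _, hs⟩ := exists_X_pow_sub_one_eq_of_odd hodd
  have hs' : (X ^ (f.natDegree + 1) + 1 : ℤ[X]) = C 2 * (s + 1) + f * (X - 1) := by
    have e2 : (C 2 : ℤ[X]) = 2 := map_ofNat C 2
    rw [e2] at hs ⊢
    linear_combination hs
  refine two_pow_le_abs_resultant (T := s + 1) (P := X - 1) hs' ?_ hne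
  rw [natDegree_X_sub_one]; omega

/-- `2^{d} ≤ |Res(f, X^{2(d+1)} + 1)|` for `f` with odd coefficients, provided the resultant is nonzero
[BDM07, (3.2) with `k = 1`]: `X^{2n} + 1 = 2 (2 s (s + 1) + 1) + f · (X - 1)(4 s + 2 + f (X - 1))`. -/
theorem two_pow_le_abs_resultant_X_pow_two_mul_add_one {f : ℤ[X]}
    (hodd : ∀ i ≤ f.natDegree, Odd (f.coeff i))
    (hne : f.resultant (X ^ (2 * (f.natDegree + 1)) + 1) f.natDegree (2 * (f.natDegree + 1)) ≠ 0) :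
    (2 : ℤ) ^ f.natDegree ≤
      |f.resultant (X ^ (2 * (f.natDegree + 1)) + 1) f.natDegree (2 * (f.natDegree + 1))| := by
  obtain ⟨s, hsdeg, hs⟩ := exists_X_pow_sub_one_eq_of_odd hodd
  set n := f.natDegree + 1 with hn
  have hs' : (X ^ (2 * n) + 1 : ℤ[X]) =
      C 2 * (C 2 * s * (s + 1) + 1) + f * ((X - 1) * (C 4 * s + C 2 + f * (X - 1))) := by
    have e2 : (C 2 : ℤ[X]) = 2 := map_ofNat C 2
    have e4 : (C 4 : ℤ[X]) = 4 := map_ofNat C 4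
    rw [e2, e4, pow_mul']
    rw [e2] at hs
    linear_combination (X ^ n - 1 + 2 * s + f * (X - 1) + 2) * hs
  refine two_pow_le_abs_resultant hs' ?_ hne
  -- degree of the cofactor: `≤ 1 + (d + 1)`
  have h4s : (C (4 : ℤ) * s + C 2 + f * (X - 1)).natDegree ≤ n := by
    refine (natDegree_add_le _ _).trans (max_le ?_ ?_)
    · refine (natDegree_add_le _ _).trans (max_le ?_ ?_)
      · exact (natDegree_C_mul_le _ _).trans hsdeg
      · simp
    · refine natDegree_mul_le.trans ?_
      rw [natDegree_X_sub_one]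
  have hP : ((X - 1) * (C (4 : ℤ) * s + C 2 + f * (X - 1))).natDegree ≤ 1 + n := by
    refine natDegree_mul_le.trans ?_
    rw [natDegree_X_sub_one]
    omega
  omega

/-! ### Nonvanishing: cyclotomic-free polynomials -/

/-- The complex roots of a cyclotomic-free integer polynomial are not roots of unity. -/
theorem pow_ne_one_of_cyclotomicFree {f : ℤ[X]} (hcf : ∀ m : ℕ, 0 < m → ¬ cyclotomic m ℤ ∣ f)
    {α : ℂ} (hα : aeval α f = 0) {N : ℕ} (hN : 0 < N) : α ^ N ≠ 1 := by
  intro hαN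
  have hfin : IsOfFinOrder α := isOfFinOrder_iff_pow_eq_one.mpr ⟨N, hN, hαN⟩
  have hord : 0 < orderOf α := hfin.orderOf_pos
  have hprim : IsPrimitiveRoot α (orderOf α) := IsPrimitiveRoot.orderOf α
  apply hcf (orderOf α) hord
  rw [cyclotomic_eq_minpoly hprim hord]
  exact minpoly.isIntegrallyClosed_dvd (hprim.isIntegral hord) hα

/-- **Resultant over `ℂ`.** For `f, G ∈ ℤ[X]` with `deg G ≤ N`, the integer `Res_{(deg f, N)}(f, G)`
equals `a^N ∏_{f(α) = 0} G(α)` over the complex roots of `f` (with multiplicity), `a` the leading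
coefficient (Mathlib's `resultant_eq_prod_eval` after base change). -/
theorem resultant_intCast_eq {f G : ℤ[X]} {N : ℕ} (hG : G.natDegree ≤ N) :
    ((f.resultant G f.natDegree N : ℤ) : ℂ) =
      (f.map (Int.castRingHom ℂ)).leadingCoeff ^ N *
        ((f.map (Int.castRingHom ℂ)).roots.map (G.map (Int.castRingHom ℂ)).eval).prod := by
  have hinj : Function.Injective (Int.castRingHom ℂ) := (Int.castRingHom ℂ).injective_int
  have hdeg : (f.map (Int.castRingHom ℂ)).natDegree = f.natDegree :=
    natDegree_map_eq_of_injective hinj f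
  rw [← eq_intCast (Int.castRingHom ℂ), ← resultant_map_map, ← hdeg]
  exact resultant_eq_prod_eval _ _ N (natDegree_map_le.trans hG) (IsAlgClosed.splits _)

/-- Membership in the complex root multiset of `f ∈ ℤ[X]`, `f ≠ 0`, means `f(α) = 0`. -/
theorem aeval_eq_zero_of_mem_roots_map {f : ℤ[X]} {α : ℂ}
    (hα : α ∈ (f.map (Int.castRingHom ℂ)).roots) : aeval α f = 0 := by
  have h := (mem_roots'.mp hα).2
  rwa [IsRoot.def, ← algebraMap_int_eq, eval_map_algebraMap] at h

/-- **Nonvanishing.** If `f ∈ ℤ[X]` is nonzero and cyclotomic-free and `G ∈ ℤ[X]` vanishes only at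
roots of unity of order dividing `L > 0` (i.e. `G(z) = 0 → z^L = 1`), then `Res(f, G) ≠ 0`. -/
theorem resultant_ne_zero_of_cyclotomicFree {f G : ℤ[X]} {N L : ℕ} (hf : f ≠ 0)
    (hcf : ∀ m : ℕ, 0 < m → ¬ cyclotomic m ℤ ∣ f) (hG : G.natDegree ≤ N) (hL : 0 < L)
    (hGL : ∀ z : ℂ, (G.map (Int.castRingHom ℂ)).eval z = 0 → z ^ L = 1) :
    f.resultant G f.natDegree N ≠ 0 := by
  intro h
  have hinj : Function.Injective (Int.castRingHom ℂ) := (Int.castRingHom ℂ).injective_int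
  have hC := resultant_intCast_eq (f := f) hG
  rw [h, Int.cast_zero] at hC
  have hlc : (f.map (Int.castRingHom ℂ)).leadingCoeff ≠ 0 := by
    rw [Ne, leadingCoeff_eq_zero, Polynomial.map_eq_zero_iff hinj]
    exact hf
  rcases mul_eq_zero.mp hC.symm with h1 | h2
  · exact hlc (pow_eq_zero_iff'.mp h1).1
  · rw [Multiset.prod_eq_zero_iff, Multiset.mem_map] at h2
    obtain ⟨α, hαmem, hα0⟩ := h2
    exact pow_ne_one_of_cyclotomicFree hcf (aeval_eq_zero_of_mem_roots_map hαmem) hL (hGL α hα0)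

/-- `Res(f, X^n - 1) ≠ 0` for `f ≠ 0` cyclotomic-free and `n > 0`. -/
theorem resultant_X_pow_sub_one_ne_zero {f : ℤ[X]} (hf : f ≠ 0)
    (hcf : ∀ m : ℕ, 0 < m → ¬ cyclotomic m ℤ ∣ f) {n : ℕ} (hn : 0 < n) :
    f.resultant (X ^ n - 1) f.natDegree n ≠ 0 := by
  refine resultant_ne_zero_of_cyclotomicFree (L := n) hf hcf ?_ hn ?_
  · rw [← C_1, natDegree_X_pow_sub_C]
  · intro z hz
    simp only [Polynomial.map_sub, Polynomial.map_pow, map_X, Polynomial.map_one, eval_sub,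
      eval_pow, eval_X, eval_one] at hz
    exact sub_eq_zero.mp hz

/-- `Res(f, X^n + 1) ≠ 0` for `f ≠ 0` cyclotomic-free and `n > 0` (a root would satisfy `z^{2n} = 1`). -/
theorem resultant_X_pow_add_one_ne_zero {f : ℤ[X]} (hf : f ≠ 0)
    (hcf : ∀ m : ℕ, 0 < m → ¬ cyclotomic m ℤ ∣ f) {n : ℕ} (hn : 0 < n) :
    f.resultant (X ^ n + 1) f.natDegree n ≠ 0 := by
  refine resultant_ne_zero_of_cyclotomicFree (L := 2 * n) hf hcf ?_ (by omega) ?_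
  · rw [← C_1, natDegree_X_pow_add_C]
  · intro z hz
    simp only [Polynomial.map_add, Polynomial.map_pow, map_X, Polynomial.map_one, eval_add,
      eval_pow, eval_X, eval_one] at hz
    have hz' : z ^ n = -1 := eq_neg_of_add_eq_zero_left hz
    rw [pow_mul', hz']; norm_num

end Summit.Ventures.DiscreteObjects.Mahler
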